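import Summits.Ventures.CertifiedQuantumChemistry.Rows.HubbardHalfFilledHeisenbergLimit
import Literature.MathematicalPhysics.QuantumLattice.HubbardPureSpinStates
import Literature.MathematicalPhysics.QuantumLattice.HeisenbergSectorEnclosureCertificate
import Literature.MathematicalPhysics.QuantumLattice.XYZGroundStateOrderHolds
import HarnessLib

/-!
# Ventures/CertifiedQuantumChemistry — Rows/HubbardHalfFilledHeisenbergSpinLimit.lean: the strong-coupling
# constant of a half-filled Hubbard sector as a sector / ground-state energy of the tree's Heisenberg Hamiltonian

HONEST FRAMING (verbatim): certified bounds for a stated model Hamiltonian in a stated basis; not a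
claim about the real molecule beyond that model.

Seat ref/typer (`pub-qchem-typer`, gen 20). THEOREMS ONLY (no `def`, no claim node, no row), zero compute,
standard axioms; NOT a row, scores nothing, moves no `CERTIFIED.md` byte. Sequel of
`Rows/HubbardHalfFilledHeisenbergLimit.lean`: there the constant is `2t² · E_{K₀}(Σ_{x∼y}(𝐒_x·𝐒_y − ¼))` with
the FERMIONIC `𝐒_x·𝐒_y` on the pure spin states `K₀` of the Fock space. The Literature dictionary
`Literature/MathematicalPhysics/QuantumLattice/HubbardPureSpinStates.lean` (`fermionSpinDot_apply_pureConfig`,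
`minEnergyOn_pure_eq_lowestEnergyInSector`, `pureState_mem_iff`, `pureState_eq_of_mem`) identifies that sector
energy with the tree's SPIN-SYSTEM sector energy (`SpinSystem` / `HeisenbergModel`: `Op Λ 2`, `spinDot`,
`spinZSector`, `lowestEnergyInSector`, `heisenbergHamiltonian n G J = J Σ_{edges} 𝐒_x·𝐒_y`). Hence, for a
half-filled sector `(a, b)`, `a + b = |Λ|`, of `hamiltonian G t U` on ANY finite graph:

* `minEnergyOn_neg_sq_eq_lowestEnergyInSector`:
  `E_{K₀}(−(hamiltonian G t 0)²) = 2t² · lowestEnergyInSector 1 (Σ_{x∼y ordered}(spinDot 1 x y − ¼·1)) ((a−b)/2)`;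
* `heisenbergForm_eq_heisenbergHamiltonian_sub`: `Σ_{x∼y ordered}(spinDot 1 x y − ¼·1) = heisenbergHamiltonian 1 G 2 − (#E/2)·1`
  (two ordered pairs per edge, the tree's `sum_sum_ite_adj_eq_sum_edgeFinset`);
* `minEnergyOn_sub_smul_one`: `E_K(A − c·1) = E_K(A) − c` (Hermitian `A`, non-trivial `K`) — so
  `minEnergyOn_neg_sq_eq_heisenbergHamiltonian`:
  `E_{K₀}(−(hamiltonian G t 0)²) = 2t² · (lowestEnergyInSector 1 (heisenbergHamiltonian 1 G 2) ((a−b)/2) − #E/2)`;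
* `tendsto_mul_minEnergyOn_hamiltonian_halfFilled_spin` / `…_heisenbergHamiltonian`: `U · E_{(a,b)}` tends to these;
* BALANCED filling `a = b` (`|Λ|` even): the `S^z = 0` sector carries the ground state of the Heisenberg
  Hamiltonian on any finite graph (the tree's `LiebMattis.lowestEnergyInSector_central_eq_groundEnergy`) and
  `E₀(heisenbergHamiltonian 1 G 2) = 2 E₀(heisenbergHamiltonian 1 G 1)` (`groundEnergy_smul_of_pos`), so
  `tendsto_mul_minEnergyOn_hamiltonian_balanced_groundEnergy`:
  **`U · E_{(a,a)}(hamiltonian G t U) → 4t² · E₀(heisenbergHamiltonian 1 G 1) − t² · #E(G)`** — Anderson's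
  antiferromagnetic superexchange `J = 4t²/U` on every bond, with the constant `−J/4` per bond;
* the TV-H ring `hubbardRingTV L 1 U`, `L = n + n`: `tendsto_mul_energy_hubbardRingTV_halfFilled_spin` (sector form),
  `tendsto_mul_energy_hubbardRingTV_halfFilled_groundEnergy`
  (`→ 4 · E₀(heisenbergHamiltonian 1 (ringGraph L) 1) − #E(ringGraph L)`), `card_edgeFinset_ringGraph`
  (`#E(ringGraph L) = L` for `3 ≤ L`) and **`tendsto_mul_energy_hubbardRingTV_halfFilled_groundEnergy_sub`:
  `U · Model.energy (hubbardRingTV L 1 U) n n → 4 · E₀(heisenbergHamiltonian 1 (ringGraph L) 1) − L = −4 h(L)`**,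
  `h(L) := L/4 − E₀(Σ_{i ∈ ℤ/L} 𝐒_i·𝐒_{i+1})`, for every even `L ≥ 4` at once; the spin-side certificates of
  `Literature/…/HeisenbergSectorEnclosureCertificate.lean` then bound this limit directly (not done here).

References: Essler et al. (2005) App. 2.A (2.A.36) [EsslerEtAl2005]; Takahashi (1999) (6.98) [Takahashi1999];
P. W. Anderson, Phys. Rev. 115 (1959) 2; Kato (1966) II §2.3 [Kato1966]; Tasaki (2020) §2.4 [Tasaki2020]. Typer gen 20.
-/

noncomputable section

namespace Summit.Ventures.CertifiedQuantumChemistry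

open Matrix Finset Filter Topology
open Literature.MathematicalPhysics.QuantumLattice Literature.MathematicalPhysics.QuantumChemistry
open Summit.Ventures.CertifiedQuantumChemistry.Hamiltonians

section Shift

variable {m : Type*} [Fintype m] [DecidableEq m]

/-- **Sector energies shift with the identity**: `E_K(A − c·1) = E_K(A) − c` for Hermitian `A`, real `c`
and a sector `K` holding a nonzero vector (the Rayleigh set is nonempty and bounded below by `E₀(A)`). -/
theorem minEnergyOn_sub_smul_one {A : Matrix m m ℂ} (hA : A.IsHermitian) (K : Submodule ℂ (m → ℂ))
    (hK : ∃ ψ ∈ K, ψ ≠ 0) (c : ℝ) :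
    (A - (c : ℂ) • (1 : Matrix m m ℂ)).minEnergyOn K = A.minEnergyOn K - c := by
  obtain ⟨ψ₀, hψ₀K, hψ₀⟩ := hK
  haveI : Nonempty m := by
    obtain ⟨i, -⟩ := Function.ne_iff.1 hψ₀
    exact ⟨i⟩
  have hray : ∀ ψ : m → ℂ, star ψ ⬝ᵥ ψ = 1 →
      (star ψ ⬝ᵥ (A - (c : ℂ) • (1 : Matrix m m ℂ)) *ᵥ ψ).re = (star ψ ⬝ᵥ A *ᵥ ψ).re - c := by
    intro ψ h1
    rw [Matrix.sub_mulVec, Matrix.smul_mulVec, Matrix.one_mulVec, dotProduct_sub, dotProduct_smul, h1,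
      smul_eq_mul, mul_one, Complex.sub_re, Complex.ofReal_re]
  set S : Set ℝ := {E : ℝ | ∃ ψ ∈ K, star ψ ⬝ᵥ ψ = 1 ∧ E = (star ψ ⬝ᵥ A *ᵥ ψ).re} with hS
  have hset : {E : ℝ | ∃ ψ ∈ K, star ψ ⬝ᵥ ψ = 1 ∧
      E = (star ψ ⬝ᵥ (A - (c : ℂ) • (1 : Matrix m m ℂ)) *ᵥ ψ).re} = (fun E => E - c) '' S := by
    ext E
    simp only [hS, Set.mem_image, Set.mem_setOf_eq]
    constructor
    · rintro ⟨ψ, hψ, h1, rfl⟩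
      exact ⟨_, ⟨ψ, hψ, h1, rfl⟩, (hray ψ h1).symm⟩
    · rintro ⟨E', ⟨ψ, hψ, h1, rfl⟩, rfl⟩
      exact ⟨ψ, hψ, h1, (hray ψ h1).symm⟩
  have hne : S.Nonempty := by
    obtain ⟨k, -, hk1⟩ := exists_smul_unit hψ₀
    exact ⟨_, k • ψ₀, K.smul_mem k hψ₀K, hk1, rfl⟩
  have hbdd : BddBelow S := by
    refine ⟨A.groundEnergy, ?_⟩
    rintro E ⟨ψ, -, h1, rfl⟩
    exact Matrix.groundEnergy_le_rayleigh_holds hA ψ h1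
  have hmono : Monotone fun E : ℝ => E - c := fun a b h => sub_le_sub_right h c
  have hcont : Continuous fun E : ℝ => E - c := continuous_id.sub continuous_const
  rw [Matrix.minEnergyOn, Matrix.minEnergyOn, hset]
  exact (hmono.map_csInf_of_continuousAt hcont.continuousAt hne hbdd).symm

end Shift

section HalfFilling

variable {Λ : Type*} [LinearOrder Λ] [Fintype Λ] (G : SimpleGraph Λ) [DecidableRel G.Adj]

/-- The ordered-pair Heisenberg form with the fermionic `𝐒_x·𝐒_y` has, on pure configurations, the matrix of
the same form with the spin-½ `spinDot 1 x y`. -/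
theorem heisenbergForm_apply_pureConfig (σ τ : Λ → Fin 2) :
    (∑ x : Λ, ∑ y : Λ, (if G.Adj x y then (1 : ℂ) else 0) •
        (fermionSpinDot x y - (1 / 4 : ℂ) • (1 : Matrix (Finset (Orb Λ)) (Finset (Orb Λ)) ℂ)))
        (pureConfig σ) (pureConfig τ) =
      (∑ x : Λ, ∑ y : Λ, (if G.Adj x y then (1 : ℂ) else 0) •
        (spinDot 1 x y - (1 / 4 : ℂ) • (1 : Matrix (Λ → Fin 2) (Λ → Fin 2) ℂ))) σ τ := by
  have h1 : (1 : Matrix (Finset (Orb Λ)) (Finset (Orb Λ)) ℂ) (pureConfig σ) (pureConfig τ) = (1 : Matrix (Λ → Fin 2) (Λ → Fin 2) ℂ) σ τ := by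
    rw [Matrix.one_apply, Matrix.one_apply]
    by_cases hστ : σ = τ
    · rw [if_pos (congrArg pureConfig hστ), if_pos hστ]
    · rw [if_neg (fun h => hστ (pureConfig_injective h)), if_neg hστ]
  simp only [Matrix.sum_apply, Matrix.smul_apply, Matrix.sub_apply, smul_eq_mul, h1]
  refine Finset.sum_congr rfl fun x _ => Finset.sum_congr rfl fun y _ => ?_
  by_cases hxy : G.Adj x y
  · rw [fermionSpinDot_apply_pureConfig (G.ne_of_adj hxy)]
  · rw [if_neg hxy, zero_mul, zero_mul]

/-- The coordinate subspace of the `(a, b)` configurations without double occupancy EXISTS as a submodule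
with the membership characterisation used throughout (`Submodule.pi (↑Z)ᶜ ⊥`, `mem_pi_compl_bot_iff`);
only that characterisation is ever used. -/
theorem exists_submodule_halfFilled_mem_iff (a b : ℕ) :
    ∃ K₀ : Submodule ℂ (Fock (Orb Λ)), ∀ ψ, ψ ∈ K₀ ↔ ∀ s : Finset (Orb Λ),
      ¬(((upPart s).card = a ∧ (downPart s).card = b) ∧ (doublyOccupied s).card = 0) → ψ s = 0 := by
  classical
  set Z : Finset (Finset (Orb Λ)) := univ.filter fun s =>
    ((upPart s).card = a ∧ (downPart s).card = b) ∧ (doublyOccupied s).card = 0 with hZ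
  refine ⟨Submodule.pi ((Z : Set (Finset (Orb Λ)))ᶜ) (fun _ => (⊥ : Submodule ℂ ℂ)), fun ψ => ?_⟩
  rw [mem_pi_compl_bot_iff]
  simp only [hZ, Finset.mem_filter, Finset.mem_univ, true_and]

/-- A half-filled sector `(a, b)`, `a + b = |Λ|`, contains a configuration without double occupancy
(`a` up-electrons on an `a`-subset `α`, the down-electrons on `αᶜ`: the tree's `pairSet α αᶜ`). -/
theorem exists_halfFilled_config {a b : ℕ} (hab : a + b = Fintype.card Λ) :
    ∃ s : Finset (Orb Λ), ((upPart s).card = a ∧ (downPart s).card = b) ∧ (doublyOccupied s).card = 0 := by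
  classical
  obtain ⟨α, -, hα⟩ := Finset.exists_subset_card_eq (s := (Finset.univ : Finset Λ)) (n := a)
    (by rw [Finset.card_univ]; omega)
  refine ⟨pairSet α αᶜ, ?_, ?_⟩
  · rw [upPart_pairSet, downPart_pairSet, Finset.card_compl, hα]
    exact ⟨rfl, by omega⟩
  · rw [doublyOccupied, upPart_pairSet, downPart_pairSet, Finset.card_eq_zero, ← Finset.disjoint_iff_inter_eq_empty]
    exact disjoint_compl_right

/-- **`E_{K₀}(−A²) = 2t² · lowestEnergyInSector 1 (Σ_{x∼y}(spinDot 1 x y − ¼)) ((a−b)/2)`** for a half-filled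
sector: the strong-coupling coefficient is a sector energy of the tree's spin-½ Heisenberg-type operator. -/
theorem minEnergyOn_neg_sq_eq_lowestEnergyInSector (t : ℝ) {a b : ℕ} (hab : a + b = Fintype.card Λ)
    {K₀ : Submodule ℂ (Fock (Orb Λ))}
    (hK₀ : ∀ ψ, ψ ∈ K₀ ↔ ∀ s : Finset (Orb Λ),
      ¬(((upPart s).card = a ∧ (downPart s).card = b) ∧ (doublyOccupied s).card = 0) → ψ s = 0) :
    (-(hamiltonian G t 0 * hamiltonian G t 0)).minEnergyOn K₀ =
      2 * t ^ 2 * lowestEnergyInSector 1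
        (∑ x : Λ, ∑ y : Λ, (if G.Adj x y then (1 : ℂ) else 0) • (spinDot 1 x y - (1 / 4 : ℂ) • (1 : Matrix (Λ → Fin 2) (Λ → Fin 2) ℂ)))
        (((a : ℝ) - b) / 2) := by
  rw [minEnergyOn_neg_sq_eq_heisenberg G t hab hK₀,
    minEnergyOn_pure_eq_lowestEnergyInSector hab hK₀ _ _ (heisenbergForm_apply_pureConfig G)]

/-- **Strong-coupling limit of a half-filled Hubbard sector as a spin-½ sector energy** (any finite graph):
`U · E_{(a,b)}(hamiltonian G t U) → 2t² · lowestEnergyInSector 1 (Σ_{x∼y}(spinDot 1 x y − ¼)) ((a−b)/2)`. -/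
theorem tendsto_mul_minEnergyOn_hamiltonian_halfFilled_spin (t : ℝ) {a b : ℕ} (hab : a + b = Fintype.card Λ) :
    Tendsto (fun U : ℝ => U * (hamiltonian G t U).minEnergyOn (szSector (a + b) (((a : ℝ) - b) / 2))) atTop
      (𝓝 (2 * t ^ 2 * lowestEnergyInSector 1
        (∑ x : Λ, ∑ y : Λ, (if G.Adj x y then (1 : ℂ) else 0) • (spinDot 1 x y - (1 / 4 : ℂ) • (1 : Matrix (Λ → Fin 2) (Λ → Fin 2) ℂ)))
        (((a : ℝ) - b) / 2))) := by
  obtain ⟨K₀, hK₀⟩ := exists_submodule_halfFilled_mem_iff (Λ := Λ) a b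
  have h := tendsto_mul_minEnergyOn_hamiltonian_halfFilled G t hab hK₀ (exists_halfFilled_config hab)
  rwa [minEnergyOn_neg_sq_eq_lowestEnergyInSector G t hab hK₀] at h

/-- **The ordered-pair Heisenberg form is the tree's Heisenberg Hamiltonian up to a constant**:
`Σ_x Σ_y [x ∼ y] (spinDot 1 x y − ¼·1) = heisenbergHamiltonian 1 G 2 − (#E(G)/2)·1` (each edge carries two
ordered pairs: `Literature…sum_sum_ite_adj_eq_sum_edgeFinset`). -/
theorem heisenbergForm_eq_heisenbergHamiltonian_sub :
    (∑ x : Λ, ∑ y : Λ, (if G.Adj x y then (1 : ℂ) else 0) •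
        (spinDot 1 x y - (1 / 4 : ℂ) • (1 : Matrix (Λ → Fin 2) (Λ → Fin 2) ℂ))) =
      heisenbergHamiltonian 1 G 2 - (((G.edgeFinset.card : ℝ) / 2 : ℝ) : ℂ) • (1 : Matrix (Λ → Fin 2) (Λ → Fin 2) ℂ) := by
  classical
  have h0 : ∀ x y : Λ, ((if G.Adj x y then (1 : ℂ) else 0) •
      (spinDot 1 x y - (1 / 4 : ℂ) • (1 : Matrix (Λ → Fin 2) (Λ → Fin 2) ℂ))) =
      (if G.Adj x y then (spinDot 1 x y - (1 / 4 : ℂ) • (1 : Matrix (Λ → Fin 2) (Λ → Fin 2) ℂ)) else 0) := by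
    intro x y
    split_ifs <;> simp
  simp only [h0]
  rw [sum_sum_ite_adj_eq_sum_edgeFinset G]
  have hterm : ∀ e ∈ G.edgeFinset,
      Sym2.lift ⟨fun x y => (spinDot 1 x y - (1 / 4 : ℂ) • (1 : Matrix (Λ → Fin 2) (Λ → Fin 2) ℂ)) +
        (spinDot 1 y x - (1 / 4 : ℂ) • (1 : Matrix (Λ → Fin 2) (Λ → Fin 2) ℂ)), fun _ _ => add_comm _ _⟩ e =
        (2 : ℂ) • spinDotSym 1 e - (1 / 2 : ℂ) • (1 : Matrix (Λ → Fin 2) (Λ → Fin 2) ℂ) := by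
    intro e _
    induction e using Sym2.ind with
    | h x y =>
      simp only [Sym2.lift_mk, spinDotSym_mk]
      rw [spinDot_comm 1 x y]
      module
  rw [Finset.sum_congr rfl hterm, Finset.sum_sub_distrib, ← Finset.smul_sum, Finset.sum_const, heisenbergHamiltonian,
    ← Nat.cast_smul_eq_nsmul ℂ, smul_smul]
  push_cast
  ring_nf

/-- At half filling `a + b = |Λ|` the spin sector `S^z = (a − b)/2` is non-trivial (the pure spin state of a
configuration without double occupancy is a nonzero vector there). -/
theorem exists_mem_spinZSector_ne_zero {a b : ℕ} (hab : a + b = Fintype.card Λ) :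
    ∃ φ ∈ spinZSector (Λ := Λ) 1 (((a : ℝ) - b) / 2), φ ≠ 0 := by
  classical
  obtain ⟨s₀, hs₀⟩ := exists_halfFilled_config (Λ := Λ) hab
  obtain ⟨K₀, hK₀⟩ := exists_submodule_halfFilled_mem_iff (Λ := Λ) a b
  set ψ : Fock (Orb Λ) := fun s => if s = s₀ then 1 else 0 with hψdef
  have hψK : ψ ∈ K₀ := by
    refine (hK₀ ψ).2 fun s hs => ?_
    simp only [hψdef]
    rw [if_neg]
    rintro rfl
    exact hs hs₀
  have hψ0 : ψ ≠ 0 := by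
    intro h
    have h1 := congrFun h s₀
    simp only [hψdef, if_pos rfl, Pi.zero_apply] at h1
    exact one_ne_zero h1
  refine ⟨fun σ => ψ (pureConfig σ), (pureState_mem_iff hab hK₀ _).1 ?_, fun h0 => hψ0 ?_⟩
  · rw [pureState_eq_of_mem hab hK₀ hψK]
    exact hψK
  · calc ψ = pureState (fun σ => ψ (pureConfig σ)) := (pureState_eq_of_mem hab hK₀ hψK).symm
      _ = pureState 0 := by rw [h0]
      _ = 0 := by funext s; simp [pureState]

/-- **`E_{K₀}(−A²) = 2t² · (E_{S^z=(a−b)/2}(heisenbergHamiltonian 1 G 2) − #E(G)/2)`**: the strong-coupling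
coefficient of a half-filled sector in terms of the tree's Heisenberg Hamiltonian `J Σ_{edges} 𝐒_x·𝐒_y`
(`J = 2`: ordered pairs) in the magnetisation sector `(a − b)/2`. -/
theorem minEnergyOn_neg_sq_eq_heisenbergHamiltonian (t : ℝ) {a b : ℕ} (hab : a + b = Fintype.card Λ)
    {K₀ : Submodule ℂ (Fock (Orb Λ))}
    (hK₀ : ∀ ψ, ψ ∈ K₀ ↔ ∀ s : Finset (Orb Λ),
      ¬(((upPart s).card = a ∧ (downPart s).card = b) ∧ (doublyOccupied s).card = 0) → ψ s = 0) :
    (-(hamiltonian G t 0 * hamiltonian G t 0)).minEnergyOn K₀ =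
      2 * t ^ 2 * (lowestEnergyInSector 1 (heisenbergHamiltonian 1 G 2) (((a : ℝ) - b) / 2) -
        (G.edgeFinset.card : ℝ) / 2) := by
  rw [minEnergyOn_neg_sq_eq_lowestEnergyInSector G t hab hK₀, heisenbergForm_eq_heisenbergHamiltonian_sub G,
    lowestEnergyInSector, lowestEnergyInSector,
    minEnergyOn_sub_smul_one (heisenbergHamiltonian_isHermitian 1 G 2) _ (exists_mem_spinZSector_ne_zero hab)]

/-- **Strong-coupling limit of a half-filled Hubbard sector via the Heisenberg Hamiltonian** (any finite
graph): `U · E_{(a,b)}(hamiltonian G t U) → 2t² · (E_{S^z=(a−b)/2}(heisenbergHamiltonian 1 G 2) − #E(G)/2)`. -/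
theorem tendsto_mul_minEnergyOn_hamiltonian_halfFilled_heisenbergHamiltonian (t : ℝ) {a b : ℕ}
    (hab : a + b = Fintype.card Λ) :
    Tendsto (fun U : ℝ => U * (hamiltonian G t U).minEnergyOn (szSector (a + b) (((a : ℝ) - b) / 2))) atTop
      (𝓝 (2 * t ^ 2 * (lowestEnergyInSector 1 (heisenbergHamiltonian 1 G 2) (((a : ℝ) - b) / 2) -
        (G.edgeFinset.card : ℝ) / 2))) := by
  obtain ⟨K₀, hK₀⟩ := exists_submodule_halfFilled_mem_iff (Λ := Λ) a b
  have h := tendsto_mul_minEnergyOn_hamiltonian_halfFilled G t hab hK₀ (exists_halfFilled_config hab)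
  rwa [minEnergyOn_neg_sq_eq_heisenbergHamiltonian G t hab hK₀] at h

/-- **Balanced half filling** (`|Λ| = a + a`): the `S^z = 0` sector carries the ground state of the Heisenberg
Hamiltonian on ANY finite graph (`LiebMattis.lowestEnergyInSector_central_eq_groundEnergy`), and
`heisenbergHamiltonian 1 G 2 = 2 • heisenbergHamiltonian 1 G 1`, so
`U · E_{(a,a)}(hamiltonian G t U) → 4t² · E₀(heisenbergHamiltonian 1 G 1) − t² · #E(G)`
— Anderson's antiferromagnetic superexchange `J = 4t²/U` on every bond, with the constant `−¼` per bond. -/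
theorem tendsto_mul_minEnergyOn_hamiltonian_balanced_groundEnergy (t : ℝ) {a : ℕ}
    (haa : a + a = Fintype.card Λ) :
    Tendsto (fun U : ℝ => U * (hamiltonian G t U).minEnergyOn (szSector (a + a) 0)) atTop
      (𝓝 (4 * t ^ 2 * (heisenbergHamiltonian 1 G 1).groundEnergy - t ^ 2 * (G.edgeFinset.card : ℝ))) := by
  have h := tendsto_mul_minEnergyOn_hamiltonian_halfFilled_heisenbergHamiltonian G t haa
  have hc : 2 * a = Fintype.card Λ * 1 := by rw [mul_one, ← haa, two_mul]
  have hcentral := LiebMattis.lowestEnergyInSector_central_eq_groundEnergy 1 G 2 a hc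
  have hM : (((Fintype.card Λ * 1 : ℕ) : ℝ) / 2 - a) = (((a : ℝ) - a) / 2) := by
    rw [← hc]; push_cast; ring
  rw [hM] at hcentral
  haveI : Nonempty (TensorIndex Λ 2) := ⟨fun _ => 0⟩
  have h2 : heisenbergHamiltonian 1 G 2 = (((2 : ℝ)) : ℂ) • heisenbergHamiltonian 1 G 1 := by
    simp only [heisenbergHamiltonian, smul_smul]
    push_cast
    ring_nf
  have hE : (heisenbergHamiltonian 1 G 2).groundEnergy = 2 * (heisenbergHamiltonian 1 G 1).groundEnergy := by
    rw [h2, groundEnergy_smul_of_pos (heisenbergHamiltonian_isHermitian 1 G 1) (by norm_num : (0 : ℝ) < 2)]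
  rw [hcentral, hE, sub_self, zero_div] at h
  convert h using 2
  ring

end HalfFilling

section Ring

/-- **The TV-H ring, every even `L`: `U · E₀(L;U) → −4 h(L)` with `h(L) = L/4 − E_Heis(L)` and `E_Heis(L)` the
`S^z = 0` sector energy of the tree's spin-½ ring operator.** For `L = n + n`,
`U · Model.energy (hubbardRingTV L 1 U) n n → 2 · lowestEnergyInSector 1 (Σ_{x∼y on ringGraph L}(spinDot 1 x y − ¼·1)) 0`
along `U → ∞` in `ℚ`. -/
theorem tendsto_mul_energy_hubbardRingTV_halfFilled_spin {L n : ℕ} (hL : n + n = L) :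
    Tendsto (fun U : ℚ => (U : ℝ) * (hubbardRingTV L 1 U).energy n n) atTop
      (𝓝 (2 * lowestEnergyInSector 1
        (∑ x : Fin L, ∑ y : Fin L, (if (ringGraph L).Adj x y then (1 : ℂ) else 0) •
          (spinDot 1 x y - (1 / 4 : ℂ) • (1 : Matrix (Fin L → Fin 2) (Fin L → Fin 2) ℂ))) 0)) := by
  obtain ⟨K₀, hK₀⟩ := exists_submodule_halfFilled_mem_iff (Λ := Fin L) n n
  have hab : n + n = Fintype.card (Fin L) := by rw [Fintype.card_fin, hL]
  have h := tendsto_mul_energy_hubbardRingTV_halfFilled hL hK₀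
  rw [minEnergyOn_pure_eq_lowestEnergyInSector hab hK₀ _ _ (heisenbergForm_apply_pureConfig (ringGraph L)),
    sub_self, zero_div] at h
  exact h

/-- **The TV-H ring, every even `L`, in the tree's Heisenberg vocabulary**: for `L = n + n`,
`U · Model.energy (hubbardRingTV L 1 U) n n → 4 · E₀(heisenbergHamiltonian 1 (ringGraph L) 1) − #E(ringGraph L)`
`= −4 h(L)`, `h(L) = #E/4 − E₀(Σ_{edges} 𝐒_x·𝐒_y)` (`#E(ringGraph L) = L` for `L ≥ 3`), along `U → ∞` in `ℚ`;
`E₀` = `Matrix.groundEnergy`, so the spin-side enclosure certificates of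
`Literature/…/HeisenbergSectorEnclosureCertificate.lean` bound the limit directly. -/
theorem tendsto_mul_energy_hubbardRingTV_halfFilled_groundEnergy {L n : ℕ} (hL : n + n = L) :
    Tendsto (fun U : ℚ => (U : ℝ) * (hubbardRingTV L 1 U).energy n n) atTop
      (𝓝 (4 * (heisenbergHamiltonian 1 (ringGraph L) 1).groundEnergy - ((ringGraph L).edgeFinset.card : ℝ))) := by
  obtain ⟨K₀, hK₀⟩ := exists_submodule_halfFilled_mem_iff (Λ := Fin L) n n
  have hab : n + n = Fintype.card (Fin L) := by rw [Fintype.card_fin, hL]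
  have h := tendsto_mul_energy_hubbardRingTV_halfFilled hL hK₀
  have hc : 2 * n = Fintype.card (Fin L) * 1 := by rw [mul_one, ← hab, two_mul]
  have hcentral := LiebMattis.lowestEnergyInSector_central_eq_groundEnergy 1 (ringGraph L) 2 n hc
  have hM : (((Fintype.card (Fin L) * 1 : ℕ) : ℝ) / 2 - n) = (((n : ℝ) - n) / 2) := by
    rw [← hc]; push_cast; ring
  rw [hM] at hcentral
  haveI : Nonempty (TensorIndex (Fin L) 2) := ⟨fun _ => 0⟩
  have h2 : heisenbergHamiltonian 1 (ringGraph L) 2 = (((2 : ℝ)) : ℂ) • heisenbergHamiltonian 1 (ringGraph L) 1 := by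
    simp only [heisenbergHamiltonian, smul_smul]
    push_cast
    ring_nf
  have hE : (heisenbergHamiltonian 1 (ringGraph L) 2).groundEnergy =
      2 * (heisenbergHamiltonian 1 (ringGraph L) 1).groundEnergy := by
    rw [h2, groundEnergy_smul_of_pos (heisenbergHamiltonian_isHermitian 1 (ringGraph L) 1) (by norm_num : (0 : ℝ) < 2)]
  rw [minEnergyOn_pure_eq_lowestEnergyInSector hab hK₀ _ _ (heisenbergForm_apply_pureConfig (ringGraph L)),
    heisenbergForm_eq_heisenbergHamiltonian_sub (ringGraph L), lowestEnergyInSector,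
    minEnergyOn_sub_smul_one (heisenbergHamiltonian_isHermitian 1 (ringGraph L) 2) _
      (exists_mem_spinZSector_ne_zero hab),
    ← lowestEnergyInSector, hcentral, hE] at h
  convert h using 2
  ring

/-- On the `L`-ring with `2 ≤ L` the successor `(i + 1) mod L` of a site differs from it. -/
private theorem succ_mod_ne_self {L : ℕ} (hL : 2 ≤ L) (i : Fin L) : (i.val + 1) % L ≠ i.val := by
  have hi := i.isLt
  rcases Nat.lt_or_ge (i.val + 1) L with h | h
  · rw [Nat.mod_eq_of_lt h]; omega
  · rw [show i.val + 1 = L by omega, Nat.mod_self]; omega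

/-- **The `L`-ring has `L` edges** (`3 ≤ L`): the edges of `ringGraph L` are the `L` distinct pairs
`{i, i + 1 mod L}`. -/
theorem card_edgeFinset_ringGraph {L : ℕ} (hL : 3 ≤ L) : (ringGraph L).edgeFinset.card = L := by
  classical
  have hL0 : 0 < L := by omega
  let nx : Fin L → Fin L := fun i => ⟨(i.val + 1) % L, Nat.mod_lt _ hL0⟩
  have hadj : ∀ i, (ringGraph L).Adj i (nx i) := fun i =>
    ⟨fun h => succ_mod_ne_self (by omega) i (congrArg Fin.val h).symm, Or.inl rfl⟩
  have himage : (ringGraph L).edgeFinset = Finset.univ.image fun i => s(i, nx i) := by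
    ext e
    rw [SimpleGraph.mem_edgeFinset, Finset.mem_image]
    induction e using Sym2.ind with
    | h p q =>
      rw [SimpleGraph.mem_edgeSet]
      constructor
      · rintro ⟨-, h | h⟩
        · exact ⟨p, Finset.mem_univ _, by rw [show nx p = q from Fin.ext h]⟩
        · refine ⟨q, Finset.mem_univ _, ?_⟩
          rw [show nx q = p from Fin.ext h, Sym2.eq_swap]
      · rintro ⟨i, -, hi⟩
        rw [Sym2.eq_iff] at hi
        rcases hi with ⟨rfl, rfl⟩ | ⟨rfl, rfl⟩
        · exact hadj i
        · exact (hadj i).symm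
  have hinj : Function.Injective fun i : Fin L => s(i, nx i) := by
    intro i j hij
    have hi := i.isLt
    have hj := j.isLt
    simp only at hij
    rw [Sym2.eq_iff] at hij
    rcases hij with ⟨h, -⟩ | ⟨h1, h2⟩
    · exact h
    · exfalso
      have e1 : i.val = (j.val + 1) % L := congrArg Fin.val h1
      have e2 : (i.val + 1) % L = j.val := congrArg Fin.val h2
      rcases Nat.lt_or_ge (j.val + 1) L with hj' | hj'
      · rw [Nat.mod_eq_of_lt hj'] at e1
        rcases Nat.lt_or_ge (i.val + 1) L with hi' | hi'
        · rw [Nat.mod_eq_of_lt hi'] at e2; omega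
        · rw [show i.val + 1 = L by omega, Nat.mod_self] at e2; omega
      · rw [show j.val + 1 = L by omega, Nat.mod_self] at e1
        rcases Nat.lt_or_ge (i.val + 1) L with hi' | hi'
        · rw [Nat.mod_eq_of_lt hi'] at e2; omega
        · rw [show i.val + 1 = L by omega, Nat.mod_self] at e2; omega
  rw [himage, Finset.card_image_of_injective _ hinj, Finset.card_univ, Fintype.card_fin]

/-- **The TV-H ring, `L = n + n ≥ 3`**: `U · Model.energy (hubbardRingTV L 1 U) n n → 4 · E₀(heisenbergHamiltonian 1 (ringGraph L) 1) − L`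
`= −4 h(L)` with `h(L) := L/4 − E₀(Σ_{i} 𝐒_i·𝐒_{i+1})`, along `U → ∞` in `ℚ`. -/
theorem tendsto_mul_energy_hubbardRingTV_halfFilled_groundEnergy_sub {L n : ℕ} (hL : n + n = L) (h3 : 3 ≤ L) :
    Tendsto (fun U : ℚ => (U : ℝ) * (hubbardRingTV L 1 U).energy n n) atTop
      (𝓝 (4 * (heisenbergHamiltonian 1 (ringGraph L) 1).groundEnergy - L)) := by
  have h := tendsto_mul_energy_hubbardRingTV_halfFilled_groundEnergy hL
  rwa [card_edgeFinset_ringGraph h3] at h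

end Ring

end Summit.Ventures.CertifiedQuantumChemistry

end
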